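import Summits.ValiantsHypothesis.ValiantsHypothesis.Theorems.KPlusLogSqLawStaticTridiagonalSupport
import Summits.ValiantsHypothesis.ValiantsHypothesis.Theorems.KPlusLogSqLawTropicalClassMonotone

/-!
# Route «KPlusLogSqLaw» — dominant chains of ANY bandwidth-one design of format `(m, K)` have `O(K · m² · log m)` terms

HONEST FRAMING.  Helper toward the crux `WeakLifting` (item `stmt-ValiantsHypothesis-19561`, route `KPlusLogSqLaw`, cell `pub-symmetroid`,
seat val-sym-lift-p3 g7, 2026-08-27) on the line of its witness-plan stub `stub_tridiagonalSectorB`: the TROPICAL side of the WHOLE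
bandwidth-one (tridiagonal) sector, all classes allowed on every band entry.  The tree's law for this sector is polynomial of degree six
(`IntervalOpt.chain_le_banded` at bandwidth one: `n + 1 ≤ (mK+1)(2m)^5`).  Here: **every chain of distinct consecutive `IsDominant` terms of a
dominance design `(d, v, ε)` of format `(m, K)` whose present entries all lie in the band `|i − j| ≤ 1` satisfies
`n + 1 ≤ (3mK + 1) · (66(m−1)(⌊log₂(m−1)⌋+2) + 1)`** (`BandOneClasses.chain_succ_le`; alternating chains: `chain_succ_le_of_alternating`) —
`O(K m² log m)`, uniformly in the exponents and the support.
PROOF.  (1) NO RETURN (`BandOneClasses.class_noReturn`, from the tree's per-entry class monotonicity `TropicalCensus.d_lt_of_isDominant_of_sameEntry`,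
p421342): along the uses of a fixed entry by the terms of the chain, a class never reappears after a different class was used.  (2) Call an index
NEW if its term uses some (entry, class) incidence that no earlier term uses; new indices inject into band incidences, so there are at most `3mK`
of them (`card_new_le`).  (3) An index interval containing no new index except possibly its left end uses at most one class per entry (by (1)),
so its terms form a dominant chain of a STATIC tridiagonal design (one class per entry, the used one; absent elsewhere) and the interval has at most
`66(m−1)(⌊log₂(m−1)⌋+2)` steps by `StaticTridiagonal.chain_le_of_support` (`interval_le`).  (4) `k ↦ (last new index ≤ k, offset)` is injective
into `(new ∪ {0}) × [0, L]`.  Nothing here asserts anything about `WeakLifting`, `TropicalB`, `KPlusLogSqLaw`, the stub in its window (its REAL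
side), `MatrixDescartes` (stmt-ValiantsHypothesis-18050) or `VP ≠ VNP`.
[folklore] (first-occurrence decomposition; bookkeeping).
-/

set_option linter.dupNamespace false
set_option autoImplicit false

namespace Summit.ValiantsHypothesis.ValiantsHypothesis.Theorems.KPlusLogSqLaw

open Finset Classical
open Summit.ValiantsHypothesis.ValiantsHypothesis.Theorems.MatrixDescartes.Negative
open Summit.ValiantsHypothesis.ValiantsHypothesis.Theorems.LacunarySymmetroidMatrixDescartes.TropicalCensus (d_lt_of_isDominant_of_sameEntry)

namespace BandOneClasses

variable {m K : ℕ}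

/-! ## 1. No return of classes along the uses of an entry -/

/-- **no return**: if the dominant terms at chain indices `k₁ < k₂ < k₃` all use the entry `(i, b)` of column `b` and the classes at `k₁`
and `k₃` agree, then the class at `k₂` is the same. [folklore] -/
theorem class_noReturn (d : Fin K → ℕ) (v ε : Fin m → Fin m → Fin K → ℤ) {n : ℕ} (θ : Fin (n + 1) → ℤ)
    (p : Fin (n + 1) → Equiv.Perm (Fin m) × (Fin m → Fin K)) (hθ : StrictMono θ) (hdom : ∀ k, IsDominant d v ε (θ k) (p k))
    {k₁ k₂ k₃ : Fin (n + 1)} (h12 : k₁ < k₂) (h23 : k₂ < k₃) (b : Fin m)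
    (e12 : (p k₁).1 b = (p k₂).1 b) (e23 : (p k₂).1 b = (p k₃).1 b) (hc : (p k₁).2 b = (p k₃).2 b) :
    (p k₂).2 b = (p k₁).2 b := by
  by_contra hne
  have h1 := d_lt_of_isDominant_of_sameEntry d v ε (hθ h12) (hdom k₁) (hdom k₂) b e12 (Ne.symm hne)
  have h2 := d_lt_of_isDominant_of_sameEntry d v ε (hθ h23) (hdom k₂) (hdom k₃) b e23 (by rw [← hc]; exact hne)
  rw [← hc] at h2
  omega

/-! ## 2. Consistent intervals are static chains -/

/-- **interval lemma**: if on the index interval `[a, a + len]` every entry is used with at most one class, the interval has at most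
`66(m−1)(⌊log₂(m−1)⌋+2)` steps. [folklore] -/
theorem interval_le (d : Fin K → ℕ) (v ε : Fin m → Fin m → Fin K → ℤ)
    (hband : ∀ i j l, ε i j l ≠ 0 → ((i : ℕ) ≤ j + 1 ∧ (j : ℕ) ≤ i + 1))
    {n : ℕ} (θ : Fin (n + 1) → ℤ) (p : Fin (n + 1) → Equiv.Perm (Fin m) × (Fin m → Fin K)) (hθ : StrictMono θ)
    (hdom : ∀ k, IsDominant d v ε (θ k) (p k)) (hne : ∀ k : Fin n, p k.castSucc ≠ p k.succ)
    (a len : ℕ) (h : a + len ≤ n)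
    (hcons : ∀ k k' : Fin (n + 1), a ≤ k → (k : ℕ) ≤ a + len → a ≤ k' → (k' : ℕ) ≤ a + len →
      ∀ j, (p k).1 j = (p k').1 j → (p k).2 j = (p k').2 j) :
    len ≤ 66 * (m - 1) * (Nat.log 2 (m - 1) + 2) := by
  -- the class table of the interval
  let a0 : Fin (n + 1) := ⟨a, by omega⟩
  let cls : Fin m → Fin m → Fin K := fun i j =>
    if hu : ∃ k : Fin (n + 1), a ≤ k ∧ (k : ℕ) ≤ a + len ∧ (p k).1 j = i then (p (Classical.choose hu)).2 j else (p a0).2 j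
  have hcls : ∀ k : Fin (n + 1), a ≤ k → (k : ℕ) ≤ a + len → ∀ j, cls ((p k).1 j) j = (p k).2 j := by
    intro k hk1 hk2 j
    have hu : ∃ k' : Fin (n + 1), a ≤ k' ∧ (k' : ℕ) ≤ a + len ∧ (p k').1 j = (p k).1 j := ⟨k, hk1, hk2, rfl⟩
    simp only [cls, dif_pos hu]
    obtain ⟨h1, h2, h3⟩ := Classical.choose_spec hu
    exact hcons _ _ h1 h2 hk1 hk2 j h3
  -- the static design of the interval
  let εc : Fin m → Fin m → Fin K → ℤ := fun i j l => if l = cls i j then ε i j l else 0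
  have hεc : ∀ i j l, εc i j l ≠ 0 → (((i : ℕ) ≤ j + 1 ∧ (j : ℕ) ≤ i + 1) ∧ l = cls i j) := by
    intro i j l hl
    simp only [εc] at hl
    split_ifs at hl with h1
    · exact ⟨hband i j l hl, h1⟩
    · exact absurd rfl hl
  -- sign of terms: a term present for `εc` is present for `ε` with the same sign; chain terms are present for `εc`
  have hsign_c : ∀ q : Equiv.Perm (Fin m) × (Fin m → Fin K), termSign εc q ≠ 0 → termSign εc q = termSign ε q := by
    intro q hq
    unfold termSign at hq ⊢
    have hprod : ∏ i, εc (q.1 i) i (q.2 i) ≠ 0 := fun h0 => hq (by rw [h0, mul_zero])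
    rw [prod_ne_zero_iff] at hprod
    congr 1
    refine prod_congr rfl fun i _ => ?_
    have hi := hprod i (mem_univ i)
    simp only [εc] at hi ⊢
    split_ifs at hi ⊢ with h1
    · rfl
    · exact absurd rfl hi
  have hsign_p : ∀ k : Fin (n + 1), a ≤ k → (k : ℕ) ≤ a + len → termSign εc (p k) = termSign ε (p k) := by
    intro k hk1 hk2
    unfold termSign
    congr 1
    refine prod_congr rfl fun i _ => ?_
    simp only [εc, if_pos (hcls k hk1 hk2 i).symm]
  -- the shifted chain
  let θ' : Fin (len + 1) → ℤ := fun k => θ ⟨a + k, by omega⟩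
  let p' : Fin (len + 1) → Equiv.Perm (Fin m) × (Fin m → Fin K) := fun k => p ⟨a + k, by omega⟩
  have hθ' : StrictMono θ' := fun x y hxy => hθ (by simp only [Fin.lt_def]; omega)
  have hdom' : ∀ k, IsDominant d v εc (θ' k) (p' k) := by
    intro k
    have hk1 : a ≤ (⟨a + k, by omega⟩ : Fin (n + 1)) := by simp
    have hk2 : ((⟨a + k, by omega⟩ : Fin (n + 1)) : ℕ) ≤ a + len := by simp; omega
    refine ⟨?_, fun q hq hqs => ?_⟩
    · show termSign εc (p ⟨a + k, _⟩) ≠ 0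
      rw [hsign_p _ hk1 hk2]; exact (hdom _).1
    · have hqs' : termSign ε q ≠ 0 := by rw [← hsign_c q hqs]; exact hqs
      exact (hdom _).2 q hq hqs'
  have hne' : ∀ k : Fin len, p' k.castSucc ≠ p' k.succ := by
    intro k heq
    have := hne ⟨a + k, by omega⟩
    apply this
    simp only [p'] at heq
    have e1 : (⟨a + k, by omega⟩ : Fin n).castSucc = ⟨a + (k.castSucc : ℕ), by simp; omega⟩ := Fin.ext (by simp)
    have e2 : (⟨a + k, by omega⟩ : Fin n).succ = ⟨a + (k.succ : ℕ), by simp; omega⟩ := Fin.ext (by simp; omega)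
    rw [e1, e2]; exact heq
  exact StaticTridiagonal.chain_le_of_support d v εc cls hεc len θ' p' hθ' hdom' hne'

/-! ## 3. New indices -/

/-- the number of band entries is at most `3m`. [folklore] -/
theorem card_band_le (m : ℕ) :
    ((univ : Finset (Fin m × Fin m)).filter fun e => ((e.1 : ℕ) ≤ e.2 + 1 ∧ (e.2 : ℕ) ≤ e.1 + 1)).card ≤ 3 * m := by
  let f : Fin m × Fin m → Fin m × Fin 3 := fun e => (e.1, ⟨((e.2 : ℕ) + 1 - e.1) % 3, Nat.mod_lt _ (by norm_num)⟩)
  calc ((univ : Finset (Fin m × Fin m)).filter fun e => ((e.1 : ℕ) ≤ e.2 + 1 ∧ (e.2 : ℕ) ≤ e.1 + 1)).card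
      ≤ (univ : Finset (Fin m × Fin 3)).card := by
        refine card_le_card_of_injOn f (fun _ _ => mem_univ _) ?_
        intro e he e' he' hfe
        rw [coe_filter] at he he'
        have h1 := he.2; have h2 := he'.2
        simp only [f, Prod.mk.injEq, Fin.mk.injEq] at hfe
        obtain ⟨hf1, hf2⟩ := hfe
        have hf1' : (e.1 : ℕ) = e'.1 := by rw [hf1]
        rw [Nat.mod_eq_of_lt (by omega), Nat.mod_eq_of_lt (by omega)] at hf2
        exact Prod.ext hf1 (Fin.ext (by omega))
    _ = 3 * m := by rw [card_univ, Fintype.card_prod, Fintype.card_fin, Fintype.card_fin]; ring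

/-- **the law for bandwidth-one designs with arbitrary classes**: `n + 1 ≤ (3mK + 1)·(66(m−1)(⌊log₂(m−1)⌋+2) + 1)`. [folklore] -/
theorem chain_succ_le (d : Fin K → ℕ) (v ε : Fin m → Fin m → Fin K → ℤ)
    (hband : ∀ i j l, ε i j l ≠ 0 → ((i : ℕ) ≤ j + 1 ∧ (j : ℕ) ≤ i + 1))
    (n : ℕ) (θ : Fin (n + 1) → ℤ) (p : Fin (n + 1) → Equiv.Perm (Fin m) × (Fin m → Fin K)) (hθ : StrictMono θ)
    (hdom : ∀ k, IsDominant d v ε (θ k) (p k)) (hne : ∀ k : Fin n, p k.castSucc ≠ p k.succ) :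
    n + 1 ≤ (3 * m * K + 1) * (66 * (m - 1) * (Nat.log 2 (m - 1) + 2) + 1) := by
  set L := 66 * (m - 1) * (Nat.log 2 (m - 1) + 2) with hL
  -- the empty matrix: all terms coincide, so the chain has one term
  rcases Nat.eq_zero_or_pos m with hm0 | hm0
  · subst hm0
    have hn : n = 0 := by
      rcases Nat.eq_zero_or_pos n with h0 | h0
      · exact h0
      · exfalso
        refine hne ⟨0, h0⟩ (Prod.ext (Subsingleton.elim _ _) (funext fun j => Fin.elim0 j))
    subst hn
    nlinarith [Nat.zero_le (3 * 0 * K), Nat.zero_le L]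
  haveI : Nonempty (Fin m) := ⟨⟨0, hm0⟩⟩
  -- incidences (kept opaque) and new indices
  obtain ⟨uses, huses⟩ : ∃ uses : Fin (n + 1) → Fin m → Fin m × Fin m × Fin K,
      ∀ k j, uses k j = ((p k).1 j, j, (p k).2 j) := ⟨fun k j => ((p k).1 j, j, (p k).2 j), fun _ _ => rfl⟩
  obtain ⟨F, hFmem⟩ : ∃ F : Finset (Fin (n + 1)), ∀ k, k ∈ F ↔ ∃ j, ∀ k' : Fin (n + 1), k' < k → uses k' j ≠ uses k j :=
    ⟨univ.filter fun k => ∃ j, ∀ k' : Fin (n + 1), k' < k → uses k' j ≠ uses k j, fun k => by rw [mem_filter]; simp⟩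
  -- (2) |F| ≤ 3 m K
  have hF : F.card ≤ 3 * m * K := by
    have hw : ∀ k ∈ F, ∃ j, ∀ k' : Fin (n + 1), k' < k → uses k' j ≠ uses k j := fun k hk => (hFmem k).mp hk
    choose! w hw using hw
    obtain ⟨B, hBmem⟩ : ∃ B : Finset (Fin m × Fin m × Fin K), ∀ t, t ∈ B ↔ ((t.1 : ℕ) ≤ t.2.1 + 1 ∧ (t.2.1 : ℕ) ≤ t.1 + 1) :=
      ⟨univ.filter fun t => ((t.1 : ℕ) ≤ t.2.1 + 1 ∧ (t.2.1 : ℕ) ≤ t.1 + 1), fun t => by rw [mem_filter]; simp⟩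
    have hmaps : ∀ k ∈ F, uses k (w k) ∈ B := by
      intro k hk
      rw [hBmem, huses]
      exact hband _ _ _ (LacunarySymmetroidMatrixDescartes.TropicalCensus.present_of_termSign_ne_zero ε (p k) (hdom k).1 (w k))
    have hinj : Set.InjOn (fun k => uses k (w k)) F := by
      intro k hk k' hk' hgk
      have hg : uses k (w k) = uses k' (w k') := hgk
      have hj : w k = w k' := by
        have h1 := congrArg (fun t => t.2.1) hg
        rw [huses, huses] at h1
        exact h1
      by_contra hkk
      rcases lt_or_gt_of_ne hkk with hlt | hlt
      · refine hw k' hk' k hlt ?_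
        rw [← hj] at hg ⊢; exact hg
      · refine hw k hk k' hlt ?_
        rw [← hj] at hg; exact hg.symm
    have h1 : F.card ≤ B.card := card_le_card_of_injOn _ hmaps hinj
    have h2 : B.card ≤ 3 * m * K := by
      obtain ⟨Bnd, hBnd⟩ : ∃ Bnd : Finset (Fin m × Fin m),
          Bnd = univ.filter (fun e => ((e.1 : ℕ) ≤ e.2 + 1 ∧ (e.2 : ℕ) ≤ e.1 + 1)) := ⟨_, rfl⟩
      have h3 : B.card ≤ (Bnd ×ˢ (univ : Finset (Fin K))).card := by
        refine card_le_card_of_injOn (fun t => ((t.1, t.2.1), t.2.2)) ?_ ?_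
        · intro t ht
          rw [mem_coe, hBmem] at ht
          rw [mem_coe, mem_product, hBnd, mem_filter]
          exact ⟨⟨mem_univ _, ht⟩, mem_univ _⟩
        · intro t _ t' _ h
          simp only [Prod.mk.injEq] at h
          obtain ⟨⟨h1, h2⟩, h3⟩ := h
          exact Prod.ext h1 (Prod.ext h2 h3)
      rw [card_product, card_univ, Fintype.card_fin] at h3
      have h4 : Bnd.card ≤ 3 * m := by rw [hBnd]; exact card_band_le m
      calc B.card ≤ _ := h3
        _ ≤ 3 * m * K := Nat.mul_le_mul_right _ h4
    exact h1.trans h2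
  -- (3) the last new index at or before `k`
  obtain ⟨G, hG⟩ : ∃ G : Finset (Fin (n + 1)), G = insert 0 F := ⟨_, rfl⟩
  have hf : ∀ k : Fin (n + 1), ∃ fk : Fin (n + 1), fk ∈ G ∧ fk ≤ k ∧ ∀ x ∈ G, x ≤ k → x ≤ fk := by
    intro k
    have hne0 : (G.filter fun x => x ≤ k).Nonempty := ⟨0, mem_filter.mpr ⟨by rw [hG]; exact mem_insert_self _ _, Fin.zero_le _⟩⟩
    refine ⟨(G.filter fun x => x ≤ k).max' hne0, (mem_filter.mp (max'_mem _ hne0)).1, (mem_filter.mp (max'_mem _ hne0)).2,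
      fun x hx hxk => le_max' _ _ (mem_filter.mpr ⟨hx, hxk⟩)⟩
  choose f hfG hfle hfmax using hf
  -- first use of an incidence
  have hfirst : ∀ (k₂ : Fin (n + 1)) (j : Fin m), ∃ f₂ : Fin (n + 1), f₂ ≤ k₂ ∧ uses f₂ j = uses k₂ j ∧
      ∀ k' : Fin (n + 1), k' < f₂ → uses k' j ≠ uses k₂ j := by
    intro k₂ j
    obtain ⟨S, hS⟩ : ∃ S : Finset (Fin (n + 1)), ∀ k', k' ∈ S ↔ uses k' j = uses k₂ j :=
      ⟨univ.filter fun k' => uses k' j = uses k₂ j, fun k' => by rw [mem_filter]; simp⟩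
    have hk₂ : k₂ ∈ S := (hS k₂).mpr rfl
    have hSne : S.Nonempty := ⟨k₂, hk₂⟩
    refine ⟨S.min' hSne, min'_le _ _ hk₂, (hS _).mp (min'_mem S hSne), fun k' hk' heq => ?_⟩
    have : S.min' hSne ≤ k' := min'_le _ _ ((hS k').mpr heq)
    exact absurd hk' (not_lt.mpr this)
  -- consistency of `[f k, k]`
  have hcons : ∀ k k₁ k₂ : Fin (n + 1), f k ≤ k₁ → k₁ ≤ k → f k ≤ k₂ → k₂ ≤ k →
      ∀ j, (p k₁).1 j = (p k₂).1 j → (p k₁).2 j = (p k₂).2 j := by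
    -- it suffices to treat `k₁ < k₂`
    suffices H : ∀ k k₁ k₂ : Fin (n + 1), f k ≤ k₁ → k₂ ≤ k → k₁ < k₂ →
        ∀ j, (p k₁).1 j = (p k₂).1 j → (p k₁).2 j = (p k₂).2 j by
      intro k k₁ k₂ h1 h2 h3 h4 j hj
      rcases lt_trichotomy k₁ k₂ with hlt | heq | hgt
      · exact H k k₁ k₂ h1 h4 hlt j hj
      · rw [heq]
      · exact (H k k₂ k₁ h3 h2 hgt j hj.symm).symm
    intro k k₁ k₂ h1 h4 hlt j hj
    by_contra hcl
    obtain ⟨f₂, hf₂le, hf₂use, hf₂first⟩ := hfirst k₂ j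
    -- `f₂` is new, hence `f₂ ≤ f k`
    have hf₂G : f₂ ∈ G := by
      rw [hG]
      refine mem_insert_of_mem ((hFmem f₂).mpr ⟨j, fun k' hk' => ?_⟩)
      rw [hf₂use]; exact hf₂first k' hk'
    have hf₂k : f₂ ≤ f k := hfmax k f₂ hf₂G (hf₂le.trans h4)
    -- the uses `f₂ < k₁ < k₂` of the entry carry the classes `l₂, l₁, l₂`: a return
    rw [huses, huses] at hf₂use
    have hrow₂ : (p f₂).1 j = (p k₂).1 j := by have := congrArg Prod.fst hf₂use; exact this
    have hcls₂ : (p f₂).2 j = (p k₂).2 j := by have := congrArg (fun t => t.2.2) hf₂use; exact this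
    have hf₂lt : f₂ < k₁ := by
      rcases lt_or_eq_of_le (hf₂k.trans h1) with h | h
      · exact h
      · exfalso; apply hcl; rw [← h, hcls₂]
    have := class_noReturn d v ε θ p hθ hdom hf₂lt hlt j (hrow₂.trans hj.symm) hj hcls₂
    exact hcl (this.trans hcls₂)
  -- (4) offsets are at most `L`
  have hoff : ∀ k : Fin (n + 1), (k : ℕ) - (f k : ℕ) ≤ L := by
    intro k
    have hfk := hfle k
    rw [Fin.le_def] at hfk
    have h := interval_le d v ε hband θ p hθ hdom hne (f k) ((k : ℕ) - (f k : ℕ)) (by have := k.isLt; omega)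
      (fun k₁ k₂ h1 h2 h3 h4 j hj => hcons k k₁ k₂ h1 (by rw [Fin.le_def]; omega) h3 (by rw [Fin.le_def]; omega) j hj)
    rw [hL]; exact h
  -- the injection `k ↦ (f k, k − f k)`
  have hι : Set.InjOn (fun k : Fin (n + 1) => (f k, (k : ℕ) - (f k : ℕ))) (univ : Finset (Fin (n + 1))) := by
    intro k _ k' _ h
    simp only [Prod.mk.injEq] at h
    obtain ⟨h1, h2⟩ := h
    have e1 := hfle k; have e2 := hfle k'
    rw [Fin.le_def] at e1 e2
    apply Fin.ext
    have : (f k : ℕ) = (f k' : ℕ) := by rw [h1]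
    omega
  have hmaps : ∀ k ∈ (univ : Finset (Fin (n + 1))), (fun k : Fin (n + 1) => (f k, (k : ℕ) - (f k : ℕ))) k ∈ G ×ˢ range (L + 1) :=
    fun k _ => mem_product.mpr ⟨hfG k, mem_range.mpr (Nat.lt_succ_of_le (hoff k))⟩
  have h1 := card_le_card_of_injOn _ hmaps hι
  rw [card_univ, Fintype.card_fin, card_product, card_range] at h1
  have h2 : G.card ≤ 3 * m * K + 1 := by rw [hG]; exact (card_insert_le _ _).trans (by omega)
  calc n + 1 ≤ G.card * (L + 1) := h1
    _ ≤ (3 * m * K + 1) * (L + 1) := Nat.mul_le_mul_right _ h2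

/-- **corollary in `TropRootLawAt` currency**: every ALTERNATING dominant chain of a bandwidth-one design of format `(m, K)` has
`n + 1 ≤ (3mK + 1)·(66(m−1)(⌊log₂(m−1)⌋+2) + 1)`. [folklore] -/
theorem chain_succ_le_of_alternating (d : Fin K → ℕ) (v ε : Fin m → Fin m → Fin K → ℤ)
    (hband : ∀ i j l, ε i j l ≠ 0 → ((i : ℕ) ≤ j + 1 ∧ (j : ℕ) ≤ i + 1))
    (n : ℕ) (θ : Fin (n + 1) → ℤ) (p : Fin (n + 1) → Equiv.Perm (Fin m) × (Fin m → Fin K)) (hθ : StrictMono θ)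
    (hdom : ∀ k, IsDominant d v ε (θ k) (p k))
    (halt : ∀ k : Fin n, termSign ε (p k.castSucc) * termSign ε (p k.succ) < 0) :
    n + 1 ≤ (3 * m * K + 1) * (66 * (m - 1) * (Nat.log 2 (m - 1) + 2) + 1) := by
  refine chain_succ_le d v ε hband n θ p hθ hdom fun k heq => ?_
  have h := halt k
  rw [heq] at h
  exact absurd h (not_lt.mpr (mul_self_nonneg _))

/-! ## 4. The same law with the tridiagonality predicate of the sector files

The registered stub `stub_tridiagonalSectorB` and `…TridiagonalPatchwork.bandedDesign_le_of_tridiagonalRealRootRow` spell the band condition as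
«`(i : ℕ) + 1 < j ∨ (j : ℕ) + 1 < i → ε i j l = 0`»; the corollaries below restate the law in that spelling so that it composes with them. -/

/-- the sector files' band condition implies the one used above. [folklore] -/
theorem band_of_vanishing {ε : Fin m → Fin m → Fin K → ℤ}
    (hband : ∀ l (i j : Fin m), (i : ℕ) + 1 < j ∨ (j : ℕ) + 1 < i → ε i j l = 0) (i j : Fin m) (l : Fin K) (h : ε i j l ≠ 0) :
    (i : ℕ) ≤ j + 1 ∧ (j : ℕ) ≤ i + 1 := by
  by_contra hc
  exact h (hband l i j (by omega))

/-- **TROPICAL ROW OF THE TRIDIAGONAL SECTOR, all classes**: every sign-alternating chain of dominant terms of a design of format `(m, K)` whose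
signs vanish off the band `|i − j| ≤ 1` (the spelling of `stub_tridiagonalSectorB`) has `n + 1 ≤ (3mK+1)·(66(m−1)(⌊log₂(m−1)⌋+2)+1)`
alternation points — `O(K m² log m)`; no symmetry of `v`, `ε` is needed. [folklore] -/
theorem tridiagonalDesign_chain_succ_le (d : Fin K → ℕ) (v ε : Fin m → Fin m → Fin K → ℤ)
    (hband : ∀ l (i j : Fin m), (i : ℕ) + 1 < j ∨ (j : ℕ) + 1 < i → ε i j l = 0)
    {n : ℕ} (θ : Fin (n + 1) → ℤ) (hθ : StrictMono θ) (p : Fin (n + 1) → Equiv.Perm (Fin m) × (Fin m → Fin K))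
    (hdom : ∀ k, IsDominant d v ε (θ k) (p k))
    (halt : ∀ k : Fin n, termSign ε (p k.castSucc) * termSign ε (p k.succ) < 0) :
    n + 1 ≤ (3 * m * K + 1) * (66 * (m - 1) * (Nat.log 2 (m - 1) + 2) + 1) :=
  chain_succ_le_of_alternating d v ε (fun i j l h => band_of_vanishing hband i j l h) n θ p hθ hdom halt

end BandOneClasses

end Summit.ValiantsHypothesis.ValiantsHypothesis.Theorems.KPlusLogSqLaw
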